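import Summits.NavierStokesRegularity.NavierStokesRegularity.Theses.AdaptedFrequency
import Literature.Analysis.FluidPDE.AdaptedBackwardKernel
import Literature.Analysis.FluidPDE.ClassicalSolution
import Literature.Analysis.FluidPDE.WholeSpaceIBP
import Literature.Analysis.FluidPDE.SpaceTimeCalculus
import Literature.Analysis.FluidPDE.MildSolutionProofs
import Literature.Analysis.FluidPDE.PineauVicolWeightPositivity
import Summits.NavierStokesRegularity.NavierStokesRegularity.Theorems.AdaptedFrequencyAdaptedFrequencyConvergesStubKernelCalculusIBP

/-! # Kato `L¹` monotonicity for the adjoint equation — crux stmt-NavierStokesRegularity-10493 (`AdaptedFrequency.AdaptedFrequencyConverges`), line cloud-frame-effective-tsai, stub stub_katoL1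

Registered stub `stub_katoL1` (`--supports stmt-NavierStokesRegularity-10493`), the first third of
the uniqueness of the Gaussian-comparable adapted backward kernel of a divergence-free drift.
For a smooth, bounded, divergence-free drift `b` on a closed time block `[s, s']` and a jointly
`C²` solution `W` of the (backward parabolic) adjoint equation `∂ₜW + b·∇W + νΔW = 0` on
`[s, s'] × ℝ³` with a Gaussian envelope, `∫ |W(s)| ≤ ∫ |W(s')|`.

Proof (Kato's inequality). With the smooth convex regularisation `ρ_δ(w) = √(w² + δ²) − δ` of
`|w|` (the tree's `PineauVicol2026.absApprox`, `0 ≤ ρ_δ ≤ |·|`, `|ρ_δ′| ≤ 1`, `ρ_δ″ ≥ 0`) and the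
tree's smooth cut-off `χ_R = cutoff R`, the functional `Φ(τ) = ∫ ρ_δ(W τ) χ_R` is continuous on
`[s, s']` and differentiable on `(s, s')` (differentiation under the integral sign on the compact
support, `kernelCalculus_hasDerivAt_integral_of_support`), with
`Φ′ = ∫ ρ_δ′(W)(−b·∇W − νΔW) χ_R ≥ ∫ ρ_δ(W)(b·∇χ_R) − ν ∫ ρ_δ(W) Δχ_R ≥ −(B C₁ + ν C₂)/R · ∫|W τ|`
(`katoSlice_integral_ge`: the chain rule `Δ(ρ∘W) = ρ′(W)ΔW + ρ″(W)|∇W|² ≥ ρ′(W)ΔW` pointwise,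
then `∫ χ (b·∇g) = −∫ (b·∇χ) g` for `div b = 0` and `∫ χ Δg = ∫ (Δχ) g`). The mean value
inequality gives `Φ(s') − Φ(s) ≥ −c/R`, uniformly thanks to the Gaussian envelope, and dominated
convergence (`δ = 1/(n+1)`, `R = n + 1 → ∞`) yields the claim.
-/

noncomputable section

namespace Summit.NavierStokesRegularity.NavierStokesRegularity.Theorems.AdaptedFrequencyConverges.CloudFrameEffectiveTsai

open scoped Topology Laplacian
open Literature.Analysis.FluidPDE Set Filter MeasureTheory Function Metric
open Literature.Analysis.FluidPDE.PineauVicol2026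
open Summit.NavierStokesRegularity.NavierStokesRegularity.Theorems.AdaptedFrequencyConverges.TauberianOmegaLimit

section General

variable {E : Type} [NormedAddCommGroup E] [InnerProductSpace ℝ E] [FiniteDimensional ℝ E]
  [MeasurableSpace E] [BorelSpace E]

/-- The regularised modulus `ρ_δ(t) = √(t² + δ²) − δ` satisfies `|ρ_δ(t)| ≤ |t|`. -/
theorem abs_absApprox_sub_le {δ : ℝ} (hδ : 0 < δ) (t : ℝ) : |absApprox δ t - δ| ≤ |t| := by
  rw [abs_le]
  constructor
  · linarith [le_absApprox hδ t, abs_nonneg t]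
  · linarith [absApprox_le hδ t]

/-- **Kato's inequality on a slice, integrated against a cut-off.** For `w ∈ C²` integrable,
a divergence-free `C¹` drift `β` with `‖β‖ ≤ B`, `ν ≥ 0`, `δ > 0`, `R ≥ 1` and the cut-off bounds
`‖Dχ_R‖ ≤ C₁/R`, `|Δχ_R| ≤ C₂/R²`:
`∫ ρ_δ′(w)(−(Dw·β + νΔw)) χ_R ≥ −((B C₁ + ν C₂)/R) ∫ |w|`
(chain rule for the Laplacian and two integrations by parts without boundary terms). -/
theorem katoSlice_integral_ge {w : E → ℝ} {β : E → E} {ν B δ R C₁ C₂ : ℝ} (hw : ContDiff ℝ 2 w)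
    (hwi : Integrable w) (hβ : ContDiff ℝ 1 β) (hdiv : VectorCalculus.IsDivFree β)
    (hB : ∀ x, ‖β x‖ ≤ B) (hν : 0 ≤ ν) (hδ : 0 < δ) (hR : 1 ≤ R) (hC₁0 : 0 ≤ C₁)
    (hC₁ : ∀ x, ‖fderiv ℝ (cutoff R : E → ℝ) x‖ ≤ C₁ / R) (hC₂0 : 0 ≤ C₂)
    (hC₂ : ∀ x, |(Δ (cutoff R : E → ℝ)) x| ≤ C₂ / R ^ 2) :
    -((B * C₁ + ν * C₂) / R * ∫ x, |w x|) ≤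
      ∫ x, deriv (absApprox δ) (w x) * (-(fderiv ℝ w x (β x) + ν * (Δ w) x)) * cutoff R x := by
  have hR0 : 0 < R := one_pos.trans_le hR
  obtain ⟨χ, hχdef⟩ : ∃ χ : E → ℝ, χ = cutoff R := ⟨_, rfl⟩
  have hχ : ContDiff ℝ 2 χ := hχdef ▸ contDiff_cutoff R
  have hχc : HasCompactSupport χ := hχdef ▸ hasCompactSupport_cutoff hR0
  have hχ0 : ∀ x, 0 ≤ χ x := fun x => hχdef ▸ cutoff_nonneg R x
  obtain ⟨ρ, hρdef⟩ : ∃ ρ : ℝ → ℝ, ρ = fun t => absApprox δ t - δ := ⟨_, rfl⟩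
  have hρ2 : ContDiff ℝ 2 ρ := hρdef ▸ (contDiff_absApprox hδ).sub contDiff_const
  have hdρ : deriv ρ = deriv (absApprox δ) := by
    rw [hρdef]; funext t; exact deriv_sub_const δ
  have hddρ : deriv (deriv ρ) = fun t => δ ^ 2 / absApprox δ t ^ 3 := by
    rw [hdρ]; exact deriv_deriv_absApprox hδ
  obtain ⟨g, hgdef⟩ : ∃ g : E → ℝ, g = ρ ∘ w := ⟨_, rfl⟩
  have hg2 : ContDiff ℝ 2 g := hgdef ▸ hρ2.comp hw
  have hρd : Differentiable ℝ ρ := hρ2.differentiable (by norm_num)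
  have hwd : Differentiable ℝ w := hw.differentiable (by norm_num)
  have hDg : ∀ x e, fderiv ℝ g x e = deriv (absApprox δ) (w x) * fderiv ℝ w x e := fun x e => by
    rw [hgdef, fderiv_comp_apply_of_deriv (hρd (w x)) (hwd x), hdρ]
  have hΔg : ∀ x, (Δ g) x = deriv (absApprox δ) (w x) * (Δ w) x +
      δ ^ 2 / absApprox δ (w x) ^ 3 * ‖gradient w x‖ ^ 2 := fun x => by
    rw [hgdef, laplacian_comp_eq hρ2 hw x, hddρ, hdρ]
  have hg_le : ∀ x, |g x| ≤ |w x| := fun x => by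
    rw [hgdef, Function.comp_apply, hρdef]
    exact abs_absApprox_sub_le hδ (w x)
  -- pointwise lower bound of the integrand
  have hpt : ∀ x, -(χ x * fderiv ℝ g x (β x)) - ν * (χ x * (Δ g) x) ≤
      deriv (absApprox δ) (w x) * (-(fderiv ℝ w x (β x) + ν * (Δ w) x)) * χ x := by
    intro x
    rw [hDg, hΔg]
    have h3 : 0 ≤ ν * (χ x * (δ ^ 2 / absApprox δ (w x) ^ 3 * ‖gradient w x‖ ^ 2)) :=
      mul_nonneg hν (mul_nonneg (hχ0 x) (mul_nonneg (deriv2_absApprox_nonneg hδ (w x))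
        (sq_nonneg _)))
    nlinarith [h3]
  -- continuity facts
  have hdψc : Continuous (deriv (absApprox δ)) :=
    (contDiff_absApprox hδ (n := 1)).continuous_deriv_one
  have hDw : Continuous (fderiv ℝ w) := hw.continuous_fderiv (by norm_num)
  have hΔw : Continuous (Δ w) := continuous_laplacian hw
  -- integrability (continuous with compact support)
  have hI_rhs : Integrable (fun x => deriv (absApprox δ) (w x) *
      (-(fderiv ℝ w x (β x) + ν * (Δ w) x)) * χ x) :=
    (((hdψc.comp hw.continuous).mul ((hDw.clm_apply hβ.continuous).add
      (continuous_const.mul hΔw)).neg).mul hχ.continuous).integrable_of_hasCompactSupport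
      hχc.mul_left
  have hI_a : Integrable (fun x => χ x * fderiv ℝ g x (β x)) :=
    (hχ.continuous.mul ((hg2.continuous_fderiv (by norm_num)).clm_apply hβ.continuous))
      |>.integrable_of_hasCompactSupport hχc.mul_right
  have hI_b : Integrable (fun x => χ x * (Δ g) x) :=
    (hχ.continuous.mul (continuous_laplacian hg2)).integrable_of_hasCompactSupport hχc.mul_right
  have hDχc : HasCompactSupport (fun x => fderiv ℝ χ x (β x)) :=
    (hχc.fderiv (𝕜 := ℝ)).mono fun x hx => by
      rw [mem_support] at hx ⊢
      contrapose! hx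
      simp [hx]
  have hΔχc : HasCompactSupport (Δ χ) :=
    HasCompactSupport.intro hχc fun x hx => laplacian_eq_zero_of_notMem_tsupport hx
  have hI_a' : Integrable (fun x => fderiv ℝ χ x (β x) * g x) :=
    (((hχ.continuous_fderiv (by norm_num)).clm_apply hβ.continuous).mul hg2.continuous)
      |>.integrable_of_hasCompactSupport hDχc.mul_right
  have hI_b' : Integrable (fun x => (Δ χ) x * g x) :=
    ((continuous_laplacian hχ).mul hg2.continuous).integrable_of_hasCompactSupport hΔχc.mul_right
  -- integration by parts
  have hibp1 : ∫ x, χ x * fderiv ℝ g x (β x) = -∫ x, fderiv ℝ χ x (β x) * g x :=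
    kernelCalculus_integral_mul_fderiv_apply (hχ.of_le one_le_two) hχc (hg2.of_le one_le_two)
      hβ hdiv
  have hibp2 : ∫ x, χ x * (Δ g) x = ∫ x, (Δ χ) x * g x :=
    kernelCalculus_integral_mul_laplacian hχ hχc hg2
  -- the boundary integrand is `O(1/R) |w|`
  have hB0 : 0 ≤ B := (norm_nonneg _).trans (hB 0)
  have hK0 : 0 ≤ (B * C₁ + ν * C₂) / R :=
    div_nonneg (add_nonneg (mul_nonneg hB0 hC₁0) (mul_nonneg hν hC₂0)) hR0.le
  have hK : ∀ x, |(fderiv ℝ χ x (β x) - ν * (Δ χ) x) * g x| ≤ (B * C₁ + ν * C₂) / R * |w x| := by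
    intro x
    rw [abs_mul]
    have h1 : |fderiv ℝ χ x (β x)| ≤ C₁ / R * B := by
      rw [← Real.norm_eq_abs]
      calc ‖fderiv ℝ χ x (β x)‖ ≤ ‖fderiv ℝ χ x‖ * ‖β x‖ := ContinuousLinearMap.le_opNorm _ _
        _ ≤ C₁ / R * B :=
          mul_le_mul (hχdef ▸ hC₁ x) (hB x) (norm_nonneg _) (div_nonneg hC₁0 hR0.le)
    have h2 : |ν * (Δ χ) x| ≤ ν * (C₂ / R) := by
      rw [abs_mul, abs_of_nonneg hν]
      refine mul_le_mul_of_nonneg_left ((hχdef ▸ hC₂ x).trans ?_) hν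
      exact div_le_div_of_nonneg_left hC₂0 hR0 (by nlinarith)
    have h3 : |fderiv ℝ χ x (β x) - ν * (Δ χ) x| ≤ (B * C₁ + ν * C₂) / R :=
      calc _ ≤ |fderiv ℝ χ x (β x)| + |ν * (Δ χ) x| := abs_sub _ _
        _ ≤ C₁ / R * B + ν * (C₂ / R) := add_le_add h1 h2
        _ = (B * C₁ + ν * C₂) / R := by ring
    exact mul_le_mul h3 (hg_le x) (abs_nonneg _) hK0
  have hI_K : Integrable (fun x => (fderiv ℝ χ x (β x) - ν * (Δ χ) x) * g x) := by
    have : (fun x => (fderiv ℝ χ x (β x) - ν * (Δ χ) x) * g x) =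
        fun x => fderiv ℝ χ x (β x) * g x - ν * ((Δ χ) x * g x) := by
      funext x; ring
    rw [this]
    exact hI_a'.sub (hI_b'.const_mul ν)
  have hI_an : Integrable (fun x => -(χ x * fderiv ℝ g x (β x))) := hI_a.neg
  -- the chain of (in)equalities
  have s1 : -((B * C₁ + ν * C₂) / R * ∫ x, |w x|) = ∫ x, -((B * C₁ + ν * C₂) / R * |w x|) := by
    rw [integral_neg, integral_const_mul]
  have s2 : ∫ x, -((B * C₁ + ν * C₂) / R * |w x|) ≤ ∫ x, (fderiv ℝ χ x (β x) - ν * (Δ χ) x) * g x :=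
    integral_mono ((hwi.abs.const_mul _).neg) hI_K fun x => neg_le_of_abs_le (hK x)
  have s3 : ∫ x, (fderiv ℝ χ x (β x) - ν * (Δ χ) x) * g x =
      (∫ x, fderiv ℝ χ x (β x) * g x) - ν * ∫ x, (Δ χ) x * g x := by
    rw [← integral_const_mul, ← integral_sub hI_a' (hI_b'.const_mul ν)]
    exact integral_congr_ae (Eventually.of_forall fun x => by ring)
  have s4 : (∫ x, fderiv ℝ χ x (β x) * g x) - ν * ∫ x, (Δ χ) x * g x =
      ∫ x, (-(χ x * fderiv ℝ g x (β x)) - ν * (χ x * (Δ g) x)) := by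
    rw [integral_sub hI_an (hI_b.const_mul ν), integral_neg, integral_const_mul, hibp1, hibp2,
      neg_neg]
  have s5 : ∫ x, (-(χ x * fderiv ℝ g x (β x)) - ν * (χ x * (Δ g) x)) ≤
      ∫ x, deriv (absApprox δ) (w x) * (-(fderiv ℝ w x (β x) + ν * (Δ w) x)) * χ x :=
    integral_mono (hI_an.sub (hI_b.const_mul ν)) hI_rhs hpt
  rw [s1, ← hχdef]
  exact s2.trans ((s3.trans s4).trans_le s5)

/-- **First variation of the regularised cut-off `L¹` functional.** For `W` jointly `C²` on
`[s, s'] × E` solving `∂ₜW + b·∇W + νΔW = 0` there (one-sided time derivative within `[s, s']`),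
`δ > 0`, `R > 0` and an interior time `τ ∈ (s, s')`,
`d/dτ ∫ ρ_δ(W τ) χ_R = ∫ ρ_δ′(W τ)(−(DW τ·b τ + νΔW τ)) χ_R`
(differentiation under the integral sign on the compact support of `χ_R`, then the equation). -/
theorem kato_hasDerivAt_cutoffIntegral {ν s s' δ R : ℝ} {b : ℝ → E → E} {W : ℝ → E → ℝ}
    (hW : ContDiffOn ℝ 2 (uncurry W) (Icc s s' ×ˢ univ))
    (hpde : ∀ τ ∈ Icc s s', ∀ x,
      timeDerivWithin (Icc s s') W τ x + fderiv ℝ (W τ) x (b τ x) + ν * (Δ (W τ)) x = 0)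
    (hδ : 0 < δ) (hR : 0 < R) {τ : ℝ} (hτ : τ ∈ Ioo s s') :
    HasDerivAt (fun r => ∫ x, (absApprox δ (W r x) - δ) * cutoff R x)
      (∫ x, deriv (absApprox δ) (W τ x) * (-(fderiv ℝ (W τ) x (b τ x) + ν * (Δ (W τ)) x)) *
        cutoff R x) τ := by
  have hS₀ : IsOpen (Ioo s s') := isOpen_Ioo
  have hW₀ : ContDiffOn ℝ 2 (uncurry W) (Ioo s s' ×ˢ univ) :=
    hW.mono (prod_mono Ioo_subset_Icc_self Subset.rfl)
  obtain ⟨Φ, hΦ⟩ : ∃ Φ : ℝ → E → ℝ, Φ = fun r x => (absApprox δ (W r x) - δ) * cutoff R x :=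
    ⟨_, rfl⟩
  have hΦ1 : ContDiffOn ℝ 1 (uncurry Φ) (Ioo s s' ×ˢ univ) := by
    have hψW : ContDiffOn ℝ 2 (fun z : ℝ × E => absApprox δ (uncurry W z)) (Ioo s s' ×ˢ univ) :=
      (contDiff_absApprox hδ).comp_contDiffOn hW₀
    have h1 : ContDiffOn ℝ 2 (fun z : ℝ × E => (absApprox δ (uncurry W z) - δ) * cutoff R z.2)
        (Ioo s s' ×ˢ univ) :=
      (hψW.sub contDiffOn_const).mul ((contDiff_cutoff R).comp_contDiffOn contDiffOn_snd)
    rw [hΦ]; exact h1.of_le one_le_two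
  have hsupp : ∀ r ∈ Ioo s s', ∀ x ∉ closedBall (0 : E) (2 * R), Φ r x = 0 := by
    intro r _ x hx
    rw [mem_closedBall_zero_iff, not_le] at hx
    simp [hΦ, cutoff_eq_zero hR hx.le]
  have hA := kernelCalculus_hasDerivAt_integral_of_support hS₀ hΦ1
    (isCompact_closedBall 0 (2 * R)) hsupp hτ
  -- the pointwise time derivative, with the equation inserted
  have hWline : ∀ x, HasDerivAt (fun r => W r x)
      (-(fderiv ℝ (W τ) x (b τ x) + ν * (Δ (W τ)) x)) τ := by
    intro x
    have h1 := kernelCalculus_hasDerivAt_timeLine hS₀ hW₀ (by norm_num) hτ x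
    have heq := hpde τ (Ioo_subset_Icc_self hτ) x
    rw [timeDerivWithin_apply, derivWithin_of_mem_nhds (Icc_mem_nhds hτ.1 hτ.2), h1.deriv] at heq
    exact h1.congr_deriv (by linarith)
  have hpt : ∀ x, fderiv ℝ (uncurry Φ) (τ, x) (1, 0) = deriv (absApprox δ) (W τ x) *
      (-(fderiv ℝ (W τ) x (b τ x) + ν * (Δ (W τ)) x)) * cutoff R x := by
    intro x
    have h1 : HasDerivAt (fun r => Φ r x) (fderiv ℝ (uncurry Φ) (τ, x) (1, 0)) τ :=
      kernelCalculus_hasDerivAt_timeLine hS₀ hΦ1 le_rfl hτ x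
    have hψd : HasDerivAt (absApprox δ) (deriv (absApprox δ) (W τ x)) (W τ x) :=
      ((contDiff_absApprox hδ (n := 1)).differentiable (by simp) _).hasDerivAt
    have h2 : HasDerivAt (fun r => Φ r x) (deriv (absApprox δ) (W τ x) *
        (-(fderiv ℝ (W τ) x (b τ x) + ν * (Δ (W τ)) x)) * cutoff R x) τ := by
      rw [hΦ]
      exact ((hψd.comp τ (hWline x)).sub_const δ).mul_const (cutoff R x)
    exact h1.unique h2
  have hfin := hA.congr_deriv (integral_congr_ae (Eventually.of_forall hpt))
  rw [hΦ] at hfin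
  exact hfin

/-- **Continuity of the regularised cut-off `L¹` functional** on the closed block `[s, s']`
(joint continuity of `W`, uniformly compact support of the cut-off). -/
theorem kato_continuousOn_cutoffIntegral {s s' δ R : ℝ} {W : ℝ → E → ℝ}
    (hW : ContDiffOn ℝ 2 (uncurry W) (Icc s s' ×ˢ univ)) (hδ : 0 < δ) (hR : 0 < R) :
    ContinuousOn (fun r => ∫ x, (absApprox δ (W r x) - δ) * cutoff R x) (Icc s s') := by
  have h1 : ContinuousOn (fun z : ℝ × E => (absApprox δ (uncurry W z) - δ) * cutoff R z.2)
      (Icc s s' ×ˢ univ) :=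
    (((contDiff_absApprox hδ (n := 0)).continuous.comp_continuousOn hW.continuousOn).sub
      continuousOn_const).mul ((contDiff_cutoff (n := 0) R).continuous.comp_continuousOn
      continuousOn_snd)
  refine continuousOn_integral_of_support_subset (Φ := fun r x => (absApprox δ (W r x) - δ) *
    cutoff R x) (isCompact_closedBall (0 : E) (2 * R)) h1 fun r _ x hx => ?_
  rw [mem_closedBall_zero_iff, not_le] at hx
  simp [cutoff_eq_zero hR hx.le]

/-- **Monotonicity up to `O(1/R)`.** Under the hypotheses of the stub (on a general space `E`),
with `M` a uniform bound for `∫ |W τ|`, `τ ∈ [s, s']`, and the cut-off constants `C₁`, `C₂`: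
`∫ ρ_δ(W s) χ_R − (B C₁ + ν C₂)/R · M · (s' − s) ≤ ∫ ρ_δ(W s') χ_R` for `δ > 0`, `R ≥ 1`
(mean value inequality from the derivative bound `katoSlice_integral_ge`). -/
theorem kato_cutoffIntegral_mono {ν B s s' δ R C₁ C₂ M : ℝ} {b : ℝ → E → E} {W : ℝ → E → ℝ}
    (hν : 0 ≤ ν) (hss' : s < s') (hb1 : ∀ τ ∈ Icc s s', ContDiff ℝ 1 (b τ))
    (hdiv : ∀ τ ∈ Icc s s', VectorCalculus.IsDivFree (b τ)) (hB : ∀ τ ∈ Icc s s', ∀ x, ‖b τ x‖ ≤ B)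
    (hW : ContDiffOn ℝ 2 (uncurry W) (Icc s s' ×ˢ univ))
    (hpde : ∀ τ ∈ Icc s s', ∀ x,
      timeDerivWithin (Icc s s') W τ x + fderiv ℝ (W τ) x (b τ x) + ν * (Δ (W τ)) x = 0)
    (hWi : ∀ τ ∈ Icc s s', Integrable (W τ)) (hM : ∀ τ ∈ Icc s s', ∫ x, |W τ x| ≤ M)
    (hδ : 0 < δ) (hR : 1 ≤ R) (hC₁0 : 0 ≤ C₁) (hC₁ : ∀ x, ‖fderiv ℝ (cutoff R : E → ℝ) x‖ ≤ C₁ / R)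
    (hC₂0 : 0 ≤ C₂) (hC₂ : ∀ x, |(Δ (cutoff R : E → ℝ)) x| ≤ C₂ / R ^ 2) :
    (∫ x, (absApprox δ (W s x) - δ) * cutoff R x) - (B * C₁ + ν * C₂) / R * M * (s' - s) ≤
      ∫ x, (absApprox δ (W s' x) - δ) * cutoff R x := by
  have hR0 : 0 < R := one_pos.trans_le hR
  have hcont := kato_continuousOn_cutoffIntegral hW hδ hR0
  have hderiv : ∀ τ ∈ Ioo s s', HasDerivAt (fun r => ∫ x, (absApprox δ (W r x) - δ) * cutoff R x)
      (∫ x, deriv (absApprox δ) (W τ x) * (-(fderiv ℝ (W τ) x (b τ x) + ν * (Δ (W τ)) x)) *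
        cutoff R x) τ := fun τ hτ => kato_hasDerivAt_cutoffIntegral hW hpde hδ hR0 hτ
  have hdiff : DifferentiableOn ℝ (fun r => ∫ x, (absApprox δ (W r x) - δ) * cutoff R x)
      (interior (Icc s s')) := by
    rw [interior_Icc]
    exact fun τ hτ => (hderiv τ hτ).differentiableAt.differentiableWithinAt
  have hB0 : 0 ≤ B := (norm_nonneg _).trans (hB s (left_mem_Icc.2 hss'.le) 0)
  have hK0 : 0 ≤ (B * C₁ + ν * C₂) / R :=
    div_nonneg (add_nonneg (mul_nonneg hB0 hC₁0) (mul_nonneg hν hC₂0)) hR0.le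
  have hge : ∀ τ ∈ interior (Icc s s'), -((B * C₁ + ν * C₂) / R * M) ≤
      deriv (fun r => ∫ x, (absApprox δ (W r x) - δ) * cutoff R x) τ := by
    rw [interior_Icc]
    intro τ hτ
    have hτ' : τ ∈ Icc s s' := Ioo_subset_Icc_self hτ
    rw [(hderiv τ hτ).deriv]
    have hslice := katoSlice_integral_ge (kernelCalculus_contDiff_slice hW hτ') (hWi τ hτ')
      (hb1 τ hτ') (hdiv τ hτ') (hB τ hτ') hν hδ hR hC₁0 hC₁ hC₂0 hC₂
    refine le_trans ?_ hslice
    exact neg_le_neg (mul_le_mul_of_nonneg_left (hM τ hτ') hK0)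
  have := (convex_Icc s s').mul_sub_le_image_sub_of_le_deriv hcont hdiff hge s
    (left_mem_Icc.2 hss'.le) s' (right_mem_Icc.2 hss'.le) hss'.le
  linarith

/-- **Removal of the cut-off and of the regularisation** (dominated convergence): for `w`
continuous and integrable, `∫ ρ_{1/(n+1)}(w) χ_{n+1} → ∫ |w|`. -/
theorem kato_tendsto_cutoffIntegral {w : E → ℝ} (hw : Continuous w) (hwi : Integrable w) :
    Tendsto (fun n : ℕ => ∫ x, (absApprox (1 / ((n : ℝ) + 1)) (w x) - 1 / ((n : ℝ) + 1)) *
      cutoff ((n : ℝ) + 1) x) atTop (𝓝 (∫ x, |w x|)) := by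
  refine tendsto_integral_of_dominated_convergence (fun x => |w x|) (fun n => ?_) hwi.abs
    (fun n => Eventually.of_forall fun x => ?_) (Eventually.of_forall fun x => ?_)
  · have hδ : (0 : ℝ) < 1 / ((n : ℝ) + 1) := by positivity
    exact ((((contDiff_absApprox hδ (n := 0)).continuous.comp hw).sub continuous_const).mul
      (contDiff_cutoff (n := 0) _).continuous).aestronglyMeasurable
  · have hδ : (0 : ℝ) < 1 / ((n : ℝ) + 1) := by positivity
    rw [Real.norm_eq_abs, abs_mul]
    calc |absApprox (1 / ((n : ℝ) + 1)) (w x) - 1 / ((n : ℝ) + 1)| * |cutoff ((n : ℝ) + 1) x|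
        ≤ |w x| * 1 :=
          mul_le_mul (abs_absApprox_sub_le hδ (w x)) (abs_cutoff_le_one _ _) (abs_nonneg _)
            (abs_nonneg _)
      _ = |w x| := mul_one _
  · have := ((tendsto_absApprox (w x)).sub tendsto_one_div_add_atTop_nhds_zero_nat).mul
      (tendsto_cutoff_natCast_add_one x)
    simpa using this

end General

/-- **Gaussian envelopes are integrable**: `x ↦ A e^{−‖x‖²/a}` is integrable for `a > 0`. -/
theorem integrable_gaussianEnvelope {E : Type} [NormedAddCommGroup E] [InnerProductSpace ℝ E]
    [FiniteDimensional ℝ E] [MeasurableSpace E] [BorelSpace E] (A : ℝ) {a : ℝ} (ha : 0 < a) :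
    Integrable (fun x : E => A * Real.exp (-‖x‖ ^ 2 / a)) := by
  have h := (integrable_exp_neg_mul_sq_norm' (E := E) (inv_pos.2 ha)).const_mul A
  refine h.congr (Eventually.of_forall fun x => ?_)
  simp only
  congr 2
  ring

/-- **Kato `L¹` monotonicity for the adjoint equation** (registered stub `stub_katoL1`): for a
smooth, bounded, divergence-free drift `b` on a closed time block `[s, s']` and a jointly `C²`
solution `W` of the adjoint equation `∂ₜW + b·∇W + νΔW = 0` on `[s, s'] × ℝ³` with a Gaussian
envelope, `∫ |W(s)| ≤ ∫ |W(s')|`. -/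
theorem stub_katoL1 :
    ∀ (ν B s s' A a : ℝ) (b : ℝ → (EuclideanSpace ℝ (Fin 3)) → (EuclideanSpace ℝ (Fin 3))) (W : ℝ → (EuclideanSpace ℝ (Fin 3)) → ℝ), 0 < ν → s < s' → 0 < a → IsSmoothSpaceTimeOn (Icc s s') b → (∀ τ ∈ Icc s s', VectorCalculus.IsDivFree (b τ)) → (∀ τ ∈ Icc s s', ∀ x, ‖b τ x‖ ≤ B) → ContDiffOn ℝ 2 (uncurry W) (Icc s s' ×ˢ univ) → (∀ τ ∈ Icc s s', ∀ x, timeDerivWithin (Icc s s') W τ x + fderiv ℝ (W τ) x (b τ x) + ν * Laplacian.laplacian (W τ) x = 0) → (∀ τ ∈ Icc s s', ∀ x, |W τ x| ≤ A * Real.exp (-‖x‖ ^ 2 / a)) → ∫ x, |W s x| ≤ ∫ x, |W s' x| := by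
  intro ν B s s' A a b W hν hss' ha hb hdiv hB hW hpde henv
  obtain ⟨C₁, hC₁0, hC₁⟩ := exists_norm_fderiv_cutoff_le (E := EuclideanSpace ℝ (Fin 3))
  obtain ⟨C₂, hC₂0, hC₂⟩ := exists_abs_laplacian_cutoff_le (E := EuclideanSpace ℝ (Fin 3))
  have henv_int := integrable_gaussianEnvelope (E := EuclideanSpace ℝ (Fin 3)) A ha
  obtain ⟨M, hMdef⟩ : ∃ M : ℝ, M = ∫ x : EuclideanSpace ℝ (Fin 3), A * Real.exp (-‖x‖ ^ 2 / a) :=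
    ⟨_, rfl⟩
  have hWc : ∀ τ ∈ Icc s s', Continuous (W τ) := fun τ hτ =>
    (kernelCalculus_contDiff_slice hW hτ).continuous
  have hWi : ∀ τ ∈ Icc s s', Integrable (W τ) := fun τ hτ =>
    henv_int.mono' (hWc τ hτ).aestronglyMeasurable (Eventually.of_forall fun x => by
      rw [Real.norm_eq_abs]; exact henv τ hτ x)
  have hM : ∀ τ ∈ Icc s s', ∫ x, |W τ x| ≤ M := fun τ hτ =>
    hMdef ▸ integral_mono (hWi τ hτ).abs henv_int (henv τ hτ)
  have hb1 : ∀ τ ∈ Icc s s', ContDiff ℝ 1 (b τ) := fun τ hτ =>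
    (hb.contDiff_slice hτ).of_le (by exact_mod_cast le_top)
  have hs : s ∈ Icc s s' := left_mem_Icc.2 hss'.le
  have hs' : s' ∈ Icc s s' := right_mem_Icc.2 hss'.le
  -- the inequality at level `n`: `δ = 1/(n+1)`, `R = n + 1`
  have key : ∀ n : ℕ,
      (∫ x, (absApprox (1 / ((n : ℝ) + 1)) (W s x) - 1 / ((n : ℝ) + 1)) * cutoff ((n : ℝ) + 1) x) -
        (B * C₁ + ν * C₂) / ((n : ℝ) + 1) * M * (s' - s) ≤
      ∫ x, (absApprox (1 / ((n : ℝ) + 1)) (W s' x) - 1 / ((n : ℝ) + 1)) * cutoff ((n : ℝ) + 1) x := by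
    intro n
    have hn : (1 : ℝ) ≤ (n : ℝ) + 1 := by simp
    have hn0 : (0 : ℝ) < (n : ℝ) + 1 := by positivity
    exact kato_cutoffIntegral_mono hν.le hss' hb1 hdiv hB hW hpde hWi hM (by positivity) hn hC₁0
      (hC₁ _ hn0) hC₂0 (hC₂ _ hn0)
  -- pass to the limit
  have hlim : ∀ τ ∈ Icc s s', Tendsto (fun n : ℕ => ∫ x, (absApprox (1 / ((n : ℝ) + 1)) (W τ x) -
      1 / ((n : ℝ) + 1)) * cutoff ((n : ℝ) + 1) x) atTop (𝓝 (∫ x, |W τ x|)) := fun τ hτ =>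
    kato_tendsto_cutoffIntegral (hWc τ hτ) (hWi τ hτ)
  have hK : Tendsto (fun n : ℕ => (B * C₁ + ν * C₂) / ((n : ℝ) + 1) * M * (s' - s))
      atTop (𝓝 0) := by
    have h1 : Tendsto (fun n : ℕ => (B * C₁ + ν * C₂) / ((n : ℝ) + 1)) atTop (𝓝 0) :=
      tendsto_const_nhds.div_atTop (tendsto_natCast_atTop_atTop.atTop_add tendsto_const_nhds)
    simpa using (h1.mul_const M).mul_const (s' - s)
  have := le_of_tendsto_of_tendsto' (((hlim s hs).sub hK)) (hlim s' hs') key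
  simpa using this

end Summit.NavierStokesRegularity.NavierStokesRegularity.Theorems.AdaptedFrequencyConverges.CloudFrameEffectiveTsai

end
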